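import Literature.Analysis.FluidPDE.LerayHopfGalileanTorusTools
import Literature.Analysis.FluidPDE.LerayHopfSpectralMeasurability
import Literature.Analysis.FluidPDE.DissipationAnomalyProofs
import Literature.Analysis.FluidPDE.NSUniqueness2DTruncatedBalance
import HarnessLib

/-!
# Galilean change of frame on the flat torus — the Leray–Hopf energy class

Analysis/FluidPDE support file (all proved), sequel of `LerayHopfGalileanTorusTools` (slice calculus).
Let `u` be a Leray–Hopf weak solution on `T^d × [0, T)` (`Torus.IsLerayHopfOn T ν (fun _ => f) u₀ u`) driven
by a STEADY smooth mean-zero force `f`, and let `V : ℝ^d` be a constant velocity.  The Galilean change of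
frame `y = x - tV` produces the boosted velocity `v t y = u t (y + [tV]) - V` (`[·] = Torus.proj`), the boosted
datum `v₀ y = u₀ y - V` and the swept force `g t y = f (y + [tV])`.  This file proves that `v` has the five
ENERGY-CLASS fields of `Torus.IsLerayHopfOn T ν g v₀ v`:

* `IsLerayHopfOn.galilean_energy_bound` — `v ∈ L^∞(0,T; L²)` (`∫⁻‖v t‖ₑ² ≤ 2C + 2‖V‖²`);
* `IsLerayHopfOn.galilean_memLp` — every slice `v t`, `t ∈ [0, T]`, is in `L²`;
* `IsLerayHopfOn.galilean_memL2Sobolev` — `v ∈ L²(0,T; H¹)` (`‖v t‖_{H¹} ≤ ‖u t‖_{H¹} + ‖V‖`);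
* `IsLerayHopfOn.galilean_energy_ineq_zero`, `IsLerayHopfOn.galilean_energy_ineq_ae` — the two energy
  inequalities of the boosted solution, from `s = 0` (given the normalisation `u 0 = u₀`) and from a.e. `s`.

The mechanism of the last two: the spectral dissipation `‖∇·‖₂²` is invariant under the frame shift slice by
slice (`Torus.eGradNormSq_comp_add_right_sub_const`), the kinetic energy shifts by
`-⟪∫ u t, V⟫ + ½‖V‖²` (`Torus.kineticEnergy_comp_add_right_sub_const`), which is CONSTANT in time because the
momentum `∫ u t` is conserved under a steady mean-zero force (`Torus.IsLerayHopfOn.integral_inner_const_eq`,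
the time-sliced weak formulation tested with constants), and the work of the swept force on the boosted field
equals the work of `f` on `u` (`∫⟪f(· + a), u t (· + a) - V⟫ = ∫⟪f, u t⟫ - ⟪∫ f, V⟫ = ∫⟪f, u t⟫`).  Hence both
sides of each energy inequality move by the same constant.

The weak formulation, the weak `L²` continuity and the strong initial trace of the boosted field are NOT
treated here (sibling files); nor is the assembly into `Torus.IsLerayHopfOn`.

Standard (U. Frisch, *Turbulence* (1995) §2.2: Galilean invariance of Navier–Stokes on the periodic box;
R. Temam, *Navier–Stokes Equations* (1984), Ch. III §1: the energy class `L^∞(0,T;H) ∩ L²(0,T;V)`).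
-/

noncomputable section

open MeasureTheory Set Filter Topology
open scoped InnerProductSpace RealInnerProductSpace ENNReal NNReal

namespace Literature.Analysis.FluidPDE.Torus

open Literature.Analysis.FunctionSpaces Literature.Analysis.FunctionSpaces.Torus UnitAddTorus

variable {d : Type*} [Fintype d] [DecidableEq d]

/-! ### Slice identities -/

/-- `(a + b)² ≤ 2a² + 2b²` in `ℝ≥0∞`. [folklore] -/
private theorem ennreal_add_sq_le_two_mul (a b : ℝ≥0∞) : (a + b) ^ 2 ≤ 2 * a ^ 2 + 2 * b ^ 2 := by
  have h := ENNReal.rpow_add_le_mul_rpow_add_rpow a b (p := 2) one_le_two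
  norm_num [ENNReal.rpow_two] at h
  simpa [mul_add] using h

omit [DecidableEq d] in
/-- Complexification commutes with the frame shift:
`complexify ∘ (w(· + a) − V) = (complexify ∘ w)(· + a) − complexify V`. [folklore] -/
theorem complexify_comp_comp_add_right_sub_const (w : UnitAddTorus d → EuclideanSpace ℝ d)
    (a : UnitAddTorus d) (V : EuclideanSpace ℝ d) :
    (EuclideanSpace.complexify ∘ fun y => w (y + a) - V) =
      fun y => (EuclideanSpace.complexify ∘ w) (y + a) - EuclideanSpace.complexify V := by
  funext y
  simp only [Function.comp_apply, map_sub]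

omit [DecidableEq d] in
/-- **`H¹` bound of a frame-shifted slice, squared**: `‖w(· + a) − V‖²_{H¹} ≤ 2‖w‖²_{H¹} + 2‖V‖²` for an `H¹`
slice `w` (complexified fields; `eSobolevNorm_comp_add_right_sub_const_le` and `(a + b)² ≤ 2a² + 2b²`).
[folklore] -/
theorem eSobolevNorm_one_complexify_comp_add_right_sub_const_sq_le {w : UnitAddTorus d → EuclideanSpace ℝ d}
    (hw : MemSobolev 1 (EuclideanSpace.complexify ∘ w)) (a : UnitAddTorus d) (V : EuclideanSpace ℝ d) :
    eSobolevNorm 1 (EuclideanSpace.complexify ∘ fun y => w (y + a) - V) ^ 2 ≤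
      2 * eSobolevNorm 1 (EuclideanSpace.complexify ∘ w) ^ 2 + 2 * ‖EuclideanSpace.complexify V‖ₑ ^ 2 := by
  rw [complexify_comp_comp_add_right_sub_const]
  calc eSobolevNorm 1 (fun y => (EuclideanSpace.complexify ∘ w) (y + a) - EuclideanSpace.complexify V) ^ 2
      ≤ (eSobolevNorm 1 (EuclideanSpace.complexify ∘ w) + ‖EuclideanSpace.complexify V‖ₑ) ^ 2 := by
        gcongr
        exact eSobolevNorm_comp_add_right_sub_const_le 1 hw.integrable a _
    _ ≤ _ := ennreal_add_sq_le_two_mul _ _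

omit [DecidableEq d] in
/-- `H¹` membership of a frame-shifted slice (complexified real fields). [folklore] -/
theorem memSobolev_complexify_comp_add_right_sub_const {s : ℝ} {w : UnitAddTorus d → EuclideanSpace ℝ d}
    (hw : MemSobolev s (EuclideanSpace.complexify ∘ w)) (a : UnitAddTorus d) (V : EuclideanSpace ℝ d) :
    MemSobolev s (EuclideanSpace.complexify ∘ fun y => w (y + a) - V) := by
  rw [complexify_comp_comp_add_right_sub_const]
  exact memSobolev_comp_add_right_sub_const hw a _

omit [DecidableEq d] in
/-- Pairing a momentum with a constant vector: `⟪∫ g, V⟫ = ∫ ⟪g, V⟫` for integrable `g`. [folklore] -/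
theorem inner_integral_left_eq_integral_inner {g : UnitAddTorus d → EuclideanSpace ℝ d}
    (hg : Integrable g volume) (V : EuclideanSpace ℝ d) : ⟪∫ y, g y, V⟫ = ∫ y, ⟪g y, V⟫ := by
  rw [real_inner_comm V (∫ y, g y), ← integral_inner hg V]
  exact integral_congr_ae (ae_of_all _ fun y => real_inner_comm _ _)

omit [DecidableEq d] in
/-- **A mean-zero force does the same work in every Galilean frame**:
`∫ ⟪g(· + a), w(· + a) − V⟫ = ∫ ⟪g, w⟫` for `g, w ∈ L²` with `∫ g = 0` (Haar invariance of the integral,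
and `∫ ⟪g, V⟫ = ⟪∫ g, V⟫ = 0`). [folklore] -/
theorem integral_inner_comp_add_right_sub_const {g w : UnitAddTorus d → EuclideanSpace ℝ d}
    (hg : MemLp g 2 volume) (hg0 : HasZeroMean g) (hw : MemLp w 2 volume) (a : UnitAddTorus d)
    (V : EuclideanSpace ℝ d) : ∫ y, ⟪g (y + a), w (y + a) - V⟫ = ∫ y, ⟪g y, w y⟫ := by
  rw [integral_add_right_eq_self (fun y => ⟪g y, w y - V⟫) a]
  have hgi : Integrable g volume := hg.integrable one_le_two
  have h1 : Integrable (fun y => ⟪g y, w y⟫) volume := integrable_inner_of_memLp_two hg hw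
  have h2 : Integrable (fun y => ⟪g y, V⟫) volume := hgi.inner_const V
  have h3 : ∫ y, ⟪g y, V⟫ = 0 := by
    rw [← inner_integral_left_eq_integral_inner hgi V, show ∫ y, g y = 0 from hg0, inner_zero_left]
  simp_rw [inner_sub_right]
  rw [integral_sub h1 h2, h3, sub_zero]

/-! ### Time-dependent bookkeeping along a Leray–Hopf solution -/

variable {T ν : ℝ} {f : UnitAddTorus d → EuclideanSpace ℝ d} {u₀ : UnitAddTorus d → EuclideanSpace ℝ d}
  {u : ℝ → UnitAddTorus d → EuclideanSpace ℝ d}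

/-- **Momentum is conserved under a steady mean-zero force**, paired with a constant vector:
`⟪∫ u t, V⟫ = ∫ ⟪u₀, V⟫` for every `t ∈ (0, T]` (time-sliced weak formulation tested with the constant
field `V`, `Torus.IsLerayHopfOn.integral_inner_const_eq`; the force term `t ⟪∫ f, V⟫` vanishes). [folklore] -/
theorem IsLerayHopfOn.inner_integral_eq_of_steady (h : IsLerayHopfOn T ν (fun _ => f) u₀ u) (hT : 0 < T)
    (hf : IsSmooth f) (hf0 : HasZeroMean f) (V : EuclideanSpace ℝ d) {t : ℝ} (ht : t ∈ Ioc 0 T) :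
    ⟪∫ y, u t y, V⟫ = ∫ y, ⟪u₀ y, V⟫ := by
  have hti : Integrable (u t) volume := (h.memLp t (Ioc_subset_Icc_self ht)).integrable one_le_two
  rw [inner_integral_left_eq_integral_inner hti V,
    h.integral_inner_const_eq hT (aestronglyMeasurable_stLift_steady hf.continuous _)
      (lintegral_Ioo_lintegral_enorm_sq_steady_lt_top (hf.memLp 2) T) V ht]
  have h0 : ∫ x, ⟪f x, V⟫ = 0 := by
    rw [← inner_integral_left_eq_integral_inner hf.integrable V, show ∫ y, f y = 0 from hf0,
      inner_zero_left]
  simp [h0]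

/-- **The dissipation is frame independent**: `∫ₛᵗ ‖∇(u τ (· + [τV]) − V)‖₂² dτ = ∫ₛᵗ ‖∇u τ‖₂² dτ` for
`0 ≤ s`, `t ≤ T` (slice-wise `Torus.eGradNormSq_comp_add_right_sub_const`, every slice being in
`L² ⊆ L¹`). [folklore] -/
theorem IsLerayHopfOn.setLIntegral_eGradNormSq_galilean (h : IsLerayHopfOn T ν (fun _ => f) u₀ u)
    (V : EuclideanSpace ℝ d) {s t : ℝ} (hs : 0 ≤ s) (ht : t ≤ T) :
    ∫⁻ τ in Ioo s t, eGradNormSq (fun y => u τ (y + FunctionSpaces.Torus.proj (τ • V)) - V) =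
      ∫⁻ τ in Ioo s t, eGradNormSq (u τ) := by
  refine setLIntegral_congr_fun measurableSet_Ioo fun τ hτ => ?_
  exact eGradNormSq_comp_add_right_sub_const
    ((h.memLp τ ⟨hs.trans hτ.1.le, hτ.2.le.trans ht⟩).integrable one_le_two) _ _

/-- **The work is frame independent**: `∫ₛᵗ ∫ ⟪f(· + [τV]), u τ (· + [τV]) − V⟫ dτ = ∫ₛᵗ ∫ ⟪f, u τ⟫ dτ`
for `0 ≤ s ≤ t ≤ T` and a steady smooth mean-zero force (slice-wise
`integral_inner_comp_add_right_sub_const`). [folklore] -/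
theorem IsLerayHopfOn.intervalIntegral_work_galilean (h : IsLerayHopfOn T ν (fun _ => f) u₀ u)
    (hf : IsSmooth f) (hf0 : HasZeroMean f) (V : EuclideanSpace ℝ d) {s t : ℝ} (hs : 0 ≤ s)
    (hst : s ≤ t) (ht : t ≤ T) :
    ∫ τ in s..t, ∫ y, ⟪f (y + FunctionSpaces.Torus.proj (τ • V)),
        u τ (y + FunctionSpaces.Torus.proj (τ • V)) - V⟫ = ∫ τ in s..t, ∫ y, ⟪f y, u τ y⟫ := by
  refine intervalIntegral.integral_congr fun τ hτ => ?_
  rw [uIcc_of_le hst] at hτ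
  exact integral_inner_comp_add_right_sub_const (hf.memLp 2) hf0
    (h.memLp τ ⟨hs.trans hτ.1, hτ.2.trans ht⟩) _ _

/-! ### The five energy-class fields of the boosted solution -/

/-- **`L^∞(0,T; L²)` bound of the boosted field**: `∫⁻ ‖u t (· + [tV]) − V‖ₑ² ≤ 2C + 2‖V‖²` for a.e.
`t ∈ (0, T)`, `C` the `L^∞_t L²_x` bound of `u` (field `energy_bound`; Temam, Ch. III §1; Frisch 1995, §2.2).
[folklore] -/
theorem IsLerayHopfOn.galilean_energy_bound (h : IsLerayHopfOn T ν (fun _ => f) u₀ u)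
    (V : EuclideanSpace ℝ d) :
    ∃ C : ℝ≥0, ∀ᵐ t ∂(volume.restrict (Ioo 0 T)),
      ∫⁻ y, ‖u t (y + FunctionSpaces.Torus.proj (t • V)) - V‖ₑ ^ 2 ≤ C := by
  obtain ⟨C, hC⟩ := h.energy_bound
  refine ⟨2 * C + 2 * ‖V‖₊ ^ 2, ?_⟩
  filter_upwards [hC] with t ht
  calc ∫⁻ y, ‖u t (y + FunctionSpaces.Torus.proj (t • V)) - V‖ₑ ^ 2
      ≤ 2 * (∫⁻ y, ‖u t y‖ₑ ^ 2) + 2 * ‖V‖ₑ ^ 2 :=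
        lintegral_enorm_sq_comp_add_right_sub_const_le (u t) _ V
    _ ≤ 2 * (C : ℝ≥0∞) + 2 * ‖V‖ₑ ^ 2 := by gcongr
    _ = ((2 * C + 2 * ‖V‖₊ ^ 2 : ℝ≥0) : ℝ≥0∞) := by
        rw [ENNReal.coe_add, ENNReal.coe_mul, ENNReal.coe_mul, ENNReal.coe_pow, ENNReal.coe_ofNat,
          enorm_eq_nnnorm]

/-- **Every slice of the boosted field is in `L²`** (field `memLp`; Haar invariance, constants are in `L²` of
the probability space `T^d`). [folklore] -/
theorem IsLerayHopfOn.galilean_memLp (h : IsLerayHopfOn T ν (fun _ => f) u₀ u) (V : EuclideanSpace ℝ d) :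
    ∀ t ∈ Icc 0 T, MemLp (fun y => u t (y + FunctionSpaces.Torus.proj (t • V)) - V) 2 volume :=
  fun t ht => memLp_comp_add_right_sub_const (h.memLp t ht) _ V

/-- **The boosted field lies in `L²(0,T; H¹)`** (field `memL2Sobolev`): slice-wise `H¹` membership is kept
(`memSobolev_comp_add_right_sub_const`) and `‖u t (· + [tV]) − V‖²_{H¹} ≤ 2‖u t‖²_{H¹} + 2‖V‖²` integrates to
`2∫₀ᵀ‖u‖²_{H¹} + 2T‖V‖² < ∞` (Temam, Ch. III §1, Thm. 3.1). [folklore] -/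
theorem IsLerayHopfOn.galilean_memL2Sobolev (h : IsLerayHopfOn T ν (fun _ => f) u₀ u)
    (V : EuclideanSpace ℝ d) :
    FunctionSpaces.Torus.MemL2Sobolev 0 T 1
      (fun t => FunctionSpaces.EuclideanSpace.complexify ∘
        fun y => u t (y + FunctionSpaces.Torus.proj (t • V)) - V) := by
  obtain ⟨hae, hfin⟩ := h.memL2Sobolev
  refine ⟨?_, ?_⟩
  · filter_upwards [hae] with t ht
    exact memSobolev_complexify_comp_add_right_sub_const ht _ V
  · unfold eL2SobolevNorm at hfin ⊢
    rw [ENNReal.rpow_lt_top_iff_of_pos (by norm_num)] at hfin ⊢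
    have hb : ∀ᵐ t ∂(volume.restrict (Ioo 0 T)),
        eSobolevNorm 1 (EuclideanSpace.complexify ∘
            fun y => u t (y + FunctionSpaces.Torus.proj (t • V)) - V) ^ 2 ≤
          2 * eSobolevNorm 1 (EuclideanSpace.complexify ∘ u t) ^ 2 +
            2 * ‖EuclideanSpace.complexify V‖ₑ ^ 2 := by
      filter_upwards [hae] with t ht
      exact eSobolevNorm_one_complexify_comp_add_right_sub_const_sq_le ht _ V
    calc ∫⁻ t in Ioo 0 T, eSobolevNorm 1 (EuclideanSpace.complexify ∘
            fun y => u t (y + FunctionSpaces.Torus.proj (t • V)) - V) ^ 2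
        ≤ ∫⁻ t in Ioo 0 T, (2 * eSobolevNorm 1 (EuclideanSpace.complexify ∘ u t) ^ 2 +
            2 * ‖EuclideanSpace.complexify V‖ₑ ^ 2) := lintegral_mono_ae hb
      _ = 2 * (∫⁻ t in Ioo 0 T, eSobolevNorm 1 (EuclideanSpace.complexify ∘ u t) ^ 2) +
            2 * ‖EuclideanSpace.complexify V‖ₑ ^ 2 * volume (Ioo (0 : ℝ) T) := by
          rw [lintegral_add_right _ measurable_const, lintegral_const_mul' _ _ ENNReal.ofNat_ne_top,
            lintegral_const, Measure.restrict_apply_univ]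
      _ < ∞ := ENNReal.add_lt_top.2 ⟨ENNReal.mul_lt_top (by simp) hfin,
            ENNReal.mul_lt_top (ENNReal.mul_lt_top (by simp) (ENNReal.pow_lt_top enorm_lt_top))
              measure_Ioo_lt_top⟩

/-- **Energy inequality of the boosted field from `s = 0`** (field `energy_ineq_zero`), for a solution
normalised to `u 0 = u₀`: both sides of the energy inequality of `u` from `0` move by the same constant
`-⟪∫ u₀, V⟫ + ½‖V‖²` (conserved momentum; frame-independent dissipation and work) (Frisch 1995, §2.2;
Temam, Ch. III §1). [folklore] -/
theorem IsLerayHopfOn.galilean_energy_ineq_zero (h : IsLerayHopfOn T ν (fun _ => f) u₀ u) (hT : 0 < T)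
    (hf : FunctionSpaces.Torus.IsSmooth f) (hf0 : FunctionSpaces.Torus.HasZeroMean f) (h0 : u 0 = u₀)
    (V : EuclideanSpace ℝ d) :
    ∀ t ∈ Icc 0 T,
      FunctionSpaces.Torus.kineticEnergy (fun y => u t (y + FunctionSpaces.Torus.proj (t • V)) - V) +
          ν * (∫⁻ τ in Ioo 0 t, FunctionSpaces.Torus.eGradNormSq
            (fun y => u τ (y + FunctionSpaces.Torus.proj (τ • V)) - V)).toReal ≤
        FunctionSpaces.Torus.kineticEnergy (fun y => u₀ y - V) +
          ∫ τ in (0 : ℝ)..t, ∫ y, ⟪f (y + FunctionSpaces.Torus.proj (τ • V)),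
            u τ (y + FunctionSpaces.Torus.proj (τ • V)) - V⟫ := by
  intro t ht
  have hu₀ : MemLp u₀ 2 volume := h0 ▸ h.memLp 0 ⟨le_rfl, hT.le⟩
  have hE : kineticEnergy (u t) + ν * (∫⁻ τ in Ioo 0 t, eGradNormSq (u τ)).toReal ≤
      kineticEnergy u₀ + ∫ τ in (0 : ℝ)..t, ∫ y, ⟪f y, u τ y⟫ := h.energy_ineq_zero t ht
  have hK0 : kineticEnergy (fun y => u₀ y - V) = kineticEnergy u₀ - ⟪∫ y, u₀ y, V⟫ + 2⁻¹ * ‖V‖ ^ 2 := by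
    have e := kineticEnergy_comp_add_right_sub_const hu₀ 0 V
    simp only [add_zero] at e
    exact e
  have hm : ⟪∫ y, u t y, V⟫ = ⟪∫ y, u₀ y, V⟫ := by
    rcases ht.1.eq_or_lt with h00 | htpos
    · rw [← h00, h0]
    · rw [h.inner_integral_eq_of_steady hT hf hf0 V ⟨htpos, ht.2⟩,
        inner_integral_left_eq_integral_inner (hu₀.integrable one_le_two) V]
  rw [kineticEnergy_comp_add_right_sub_const (h.memLp t ht), h.setLIntegral_eGradNormSq_galilean V le_rfl ht.2,
    h.intervalIntegral_work_galilean hf hf0 V le_rfl ht.1 ht.2, hK0, hm]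
  linarith

/-- **Energy inequality of the boosted field from a.e. `s ∈ (0, T)`** (field `energy_ineq_ae`): for the
a.e. `s` of the energy inequality of `u`, both sides move by the same constant `-⟪∫ u s, V⟫ + ½‖V‖²`,
`⟪∫ u t, V⟫ = ⟪∫ u s, V⟫` by momentum conservation (Frisch 1995, §2.2; Temam, Ch. III §1). [folklore] -/
theorem IsLerayHopfOn.galilean_energy_ineq_ae (h : IsLerayHopfOn T ν (fun _ => f) u₀ u) (hT : 0 < T)
    (hf : FunctionSpaces.Torus.IsSmooth f) (hf0 : FunctionSpaces.Torus.HasZeroMean f)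
    (V : EuclideanSpace ℝ d) :
    ∀ᵐ s ∂(volume.restrict (Ioo 0 T)), ∀ t ∈ Icc s T,
      FunctionSpaces.Torus.kineticEnergy (fun y => u t (y + FunctionSpaces.Torus.proj (t • V)) - V) +
          ν * (∫⁻ τ in Ioo s t, FunctionSpaces.Torus.eGradNormSq
            (fun y => u τ (y + FunctionSpaces.Torus.proj (τ • V)) - V)).toReal ≤
        FunctionSpaces.Torus.kineticEnergy (fun y => u s (y + FunctionSpaces.Torus.proj (s • V)) - V) +
          ∫ τ in s..t, ∫ y, ⟪f (y + FunctionSpaces.Torus.proj (τ • V)),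
            u τ (y + FunctionSpaces.Torus.proj (τ • V)) - V⟫ := by
  filter_upwards [h.energy_ineq_ae, ae_restrict_mem measurableSet_Ioo] with s hs hsI t hst
  have hsT : s ∈ Icc 0 T := ⟨hsI.1.le, hsI.2.le⟩
  have htT : t ∈ Icc 0 T := ⟨hsI.1.le.trans hst.1, hst.2⟩
  have hE : kineticEnergy (u t) + ν * (∫⁻ τ in Ioo s t, eGradNormSq (u τ)).toReal ≤
      kineticEnergy (u s) + ∫ τ in s..t, ∫ y, ⟪f y, u τ y⟫ := hs t hst
  rw [kineticEnergy_comp_add_right_sub_const (h.memLp t htT),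
    kineticEnergy_comp_add_right_sub_const (h.memLp s hsT),
    h.setLIntegral_eGradNormSq_galilean V hsI.1.le hst.2,
    h.intervalIntegral_work_galilean hf hf0 V hsI.1.le hst.1 hst.2,
    h.inner_integral_eq_of_steady hT hf hf0 V ⟨hsI.1.trans_le hst.1, hst.2⟩,
    h.inner_integral_eq_of_steady hT hf hf0 V ⟨hsI.1, hsI.2.le⟩]
  linarith

end Literature.Analysis.FluidPDE.Torus
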